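/-
Copyright (c) 2026 the pub-hodgecm-mathlib formalisation cell (harness21).  Prover seat hodgecm-mathlib-K2E2-p12 (g5): Track B «K2-LIT», ENGINE E1,
h413 = stmt-HodgeConjecture-24833; DEAL deck #1b «W-BOUNDS-UNIFORM» of the dealer K2E1-plan (g4) 2026-09-04T07:39:35Z (campaign «EIS-WHITTAKER-2», the two
🆕 uniform bounds of the W5-FINAL wiring table `WIRING-W5-FINAL-EisWhittaker2.K2E1b-plan-g5.md` §3, row `hWbd`).
-/
import Summits.HodgeConjecture.HodgeConjecture.Theorems.F0P2wPartialDedekindZetaPole   -- ★ `hasProd_partialDedekindZeta`, `norm_residueCard_cpow_neg_le` (partial Dedekind zeta currency)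
import Literature.NumberTheory.Automorphic.AddCharConductorExponent                    -- ★ `mem_primePowBall_adicCompletion_iff` (local balls ↔ `Valued.v`)
import Mathlib.NumberTheory.NumberField.ProductFormula                                 -- Mathlib: `FinitePlace.prod_eq_inv_abs_norm`, `InfinitePlace.prod_eq_abs_norm`
import Mathlib.NumberTheory.NumberField.AdeleRing                                      -- Mathlib: `AdeleRing`, `InfiniteAdeleRing.ringEquiv_mixedSpace` (W4's letters)
import HarnessLib

/-!
# K2·E1 — `K2E1WhittakerBoundsUniformU2`: TWO UNIFORM BOUNDS FOR THE WHITTAKER COEFFICIENTS OF THE SPHERICAL EISENSTEIN SERIES ON `U(J₂)`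
# (campaign «EIS-WHITTAKER-2», deck #1b «W-BOUNDS-UNIFORM»: the `ζ^S(2z)⁻¹` factor UNIFORMLY IN `S`, and the divisor-type factor `∏_v 2(n_v+1)` by the PRODUCT FORMULA)

Track B ∕ K2-LIT, crux h413 = `stmt-HodgeConjecture-24833`, route of record `HCCMUnconditional`; cell `hodgecm-mathlib`, squad K2, ENGINE E1 (dealer K2E1-plan (g4)),
campaign «EIS-WHITTAKER-2», deck #1b (spec 07:39:35Z; wiring table «W5-FINAL» of K2E1b-plan (g5) §0 row `hWbd`, §3 «uniform inverse partial zeta bound» +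
«product-formula bound»).  THEOREMS ONLY (no `def`, no `instance`, no notation, no named-fact hypothesis, no `sorry`; default heartbeats); lane
`--supports stmt-HodgeConjecture-24833 --as helper` (count-neutral).  Generic number field `K` (the campaign's `K = L⁺`).  Closes no socket.

THE MATHEMATICS.  In the closed form of the `ξ`-th Whittaker coefficient of the spherical Eisenstein series (W3 ∕ W3-cov ∕ W2-fin: `𝒲(z, η) = W_∞(z, η_∞) ·
∏_{v ∈ S(η)} W_v(z, η_v) · ζ^{S(η)}_K(2z)⁻¹` at the adelic frequency `η = ξ·α_F⁻¹`, `S(η)` a finite set of places DEPENDING ON `ξ`), W4's hypothesis (hWbd) (★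
`K2E1WhittakerSeriesConvergenceU2.summable_differentiableOn_tsum_of_exp_bounds`: ONE bound `M·e^{−b‖ξ_∞‖}·(1 + ‖ξ_∞‖)^a` on a strip, ONE compact `ξ_f`-support) needs two
estimates that are uniform in the moving finite set `S(η)`:
* §1 **`norm_inv_partialZeta_le_uniform`** ∕ **`norm_inv_partialZeta_two_mul_le_uniform`** — for `x₁ > 1` there is ONE `C = exp(Σ_v q_v^{−x₁})` with
  `‖ζ^S_K(w)⁻¹‖ ≤ C` for EVERY set `S` of finite places and every `Re w ≥ x₁` (so `‖ζ^S_K(2z)⁻¹‖ ≤ C` on `Re z ≥ x₀ > ½`): `ζ^S_K(w)⁻¹ = ∏'_{v ∉ S}(1 − q_v^{−w})` (★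
  `hasProd_partialDedekindZeta`, inverted), every partial product has norm `≤ ∏(1 + q_v^{−x₁}) ≤ exp(Σ_{v} q_v^{−x₁})` (`1 + t ≤ e^t`, ★ `summable_residueCard_rpow_neg`), and
  the bound passes to the limit.  [NeukirchANT1999, Ch. VII (5.2)]
* §2 the integer arithmetic `n + 1 ≤ q^n`, `2(n + 1) ≤ q^{2n}` (`n ≥ 1`, `q ≥ 2`).
* §3 **the product formula in the campaign's currency**: for `ξ ∈ Kˣ`, `‖ξ‖_v := adicAbv K v ξ = q_v^{−ord_v ξ}` (Mathlib `toNNReal (absNorm v) (v.valuation K ξ)`,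
  `q_v = v.residueCard = absNorm v`), `∏ᶠ_v ‖ξ‖_v = |N_{K∕ℚ} ξ|⁻¹` (Mathlib `FinitePlace.prod_eq_inv_abs_norm`) and `|N_{K∕ℚ} ξ| = ∏_{w∣∞} |ξ|_w^{mult w} ≤ ‖ξ_∞‖^{[K:ℚ]}`
  (Mathlib `InfinitePlace.prod_eq_abs_norm`, `‖ξ_∞‖` = the sup norm of `mixedEmbedding K ξ`); hence **`prod_residueCard_pow_le_mul_abs_norm`**: if `ord_v ξ ≥ e_v` for all
  `v` (`ξ` in the box `∏_v 𝔭_v^{e_v}`, `e` finitely supported) and `ord_v ξ = e_v + n_v` on a finite set `T`, then `∏_{v∈T} q_v^{n_v} ≤ (∏_{v} q_v^{−e_v})·|N_{K∕ℚ} ξ|`.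
  [NeukirchANT1999, Ch. III (1.3)]
* §4 HEAD **`exists_prod_two_mul_succ_le`** — the «product-formula bound» of the wiring table: for `e` finitely supported and a finite `S₀` (the places where `n_v = 0`
  is allowed: `S_δ ∪ supp m ∪ supp α_F`) there is ONE `C > 0` with, for every `ξ ∈ Kˣ` in the box and every finite `T`, `n : T → ℕ` with `ord_v ξ = e_v + n_v` and
  (`v ∈ S₀` or `n_v ≥ 1`) on `T`:  `∏_{v∈T} 2(n_v + 1) ≤ C·(1 + ‖ξ_∞‖)^{2[K:ℚ]}` — plus the corollary **`exists_prod_two_mul_succ_le_infiniteAdele`** in W4's letters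
  `‖ξ_∞‖ = ‖ringEquiv_mixedSpace K (algebraMap K 𝔸_K ξ).1‖`, and the dictionary **`coe_mem_primePowBall_iff_valuation_le`** (`(ξ : K_v) ∈ 𝔭_v^m ⟺ v.valuation K ξ ≤ exp(−m)`)
  that turns ★ p858310's binders `hn : η_v ∈ 𝔭^{m+n}`, `hn' : η_v ∉ 𝔭^{m+n+1}` into the hypothesis `v.valuation K ξ = exp(−(e_v + n_v))`.
HONEST LABEL: HC_CM is proved only modulo the 7 printed citations (2 remaining named inputs: hLiu418 = `stmt-HodgeConjecture-24832`, h413 = `stmt-HodgeConjecture-24833`) until rung 0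
closes; this file asserts no named fact, closes no socket and crosses no ceiling by itself.

## References
* [NeukirchANT1999] J. Neukirch, *Algebraic Number Theory* (1999): Ch. III (1.3) (product formula), Ch. VII (5.2) (Euler product of `ζ_K`).
* [Garrett2018] P. Garrett, *Modern Analysis of Automorphic Forms by Example* 1 (2018), §2.8 (Fourier–Whittaker expansions of Eisenstein series: divisor-sum coefficients).
* [MoeglinWaldspurger1995] C. Mœglin, J.-L. Waldspurger, *Spectral Decomposition and Eisenstein Series* (1995): I.2.10.
-/

set_option autoImplicit false
set_option linter.dupNamespace false -- the mandated namespace repeats `HodgeConjecture.HodgeConjecture`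

noncomputable section

open scoped NNReal Classical
open Filter Topology Complex NumberField IsDedekindDomain Module
open Literature.NumberTheory.Automorphic Literature.NumberTheory.LFunctions Literature.NumberTheory.GaloisRepresentations

namespace Summit.HodgeConjecture.HodgeConjecture.Cruxes.H413.K2E1WhittakerBoundsUniformU2

open Summit.HodgeConjecture.HodgeConjecture.Cruxes.H413.F0P2wPartialDedekindZetaPole

variable {K : Type} [Field K] [NumberField K]

/-! ## §1 `‖ζ^S_K(w)⁻¹‖ ≤ exp(Σ_v q_v^{−x₁})` for `Re w ≥ x₁ > 1`, uniformly in the set `S` of omitted places -/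

/-- One place: `‖1 − q_v^{−w}‖ ≤ 1 + q_v^{−x₁} ≤ exp(q_v^{−x₁})` for `x₁ ≤ Re w`. [cite: NeukirchANT1999, Ch. VII (5.2)] -/
theorem norm_one_sub_residueCard_cpow_neg_le_exp (v : HeightOneSpectrum (𝓞 K)) {x₁ : ℝ} {w : ℂ} (hw : x₁ ≤ w.re) :
    ‖1 - (v.residueCard : ℂ) ^ (-w)‖ ≤ Real.exp ((v.residueCard : ℝ) ^ (-x₁)) :=
  calc ‖1 - (v.residueCard : ℂ) ^ (-w)‖ ≤ ‖(1 : ℂ)‖ + ‖(v.residueCard : ℂ) ^ (-w)‖ := norm_sub_le _ _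
    _ ≤ 1 + (v.residueCard : ℝ) ^ (-x₁) := by rw [norm_one]; exact add_le_add le_rfl (norm_residueCard_cpow_neg_le v hw)
    _ ≤ Real.exp ((v.residueCard : ℝ) ^ (-x₁)) := by rw [add_comm]; exact Real.add_one_le_exp _

/-- Finite products: for every finite set `T` of places off `S` and `x₁ ≤ Re w`, `x₁ > 1`,
`‖∏_{v∈T} (1 − q_v^{−w})‖ ≤ exp(Σ_{v∈T} q_v^{−x₁}) ≤ exp(Σ_{v} q_v^{−x₁})` — a bound free of `T`, `S` and `w`
(★ `summable_residueCard_rpow_neg`). [cite: NeukirchANT1999, Ch. VII (5.2)] -/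
theorem norm_prod_one_sub_residueCard_cpow_neg_le {x₁ : ℝ} (hx₁ : 1 < x₁) (S : Set (HeightOneSpectrum (𝓞 K))) {w : ℂ} (hw : x₁ ≤ w.re)
    (T : Finset {v : HeightOneSpectrum (𝓞 K) // v ∉ S}) :
    ‖∏ v ∈ T, (1 - (v.1.residueCard : ℂ) ^ (-w))‖ ≤ Real.exp (∑' v : HeightOneSpectrum (𝓞 K), (v.residueCard : ℝ) ^ (-x₁)) := by
  have hsum := summable_residueCard_rpow_neg (K := K) hx₁
  calc ‖∏ v ∈ T, (1 - (v.1.residueCard : ℂ) ^ (-w))‖ = ∏ v ∈ T, ‖1 - (v.1.residueCard : ℂ) ^ (-w)‖ := norm_prod _ _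
    _ ≤ ∏ v ∈ T, Real.exp ((v.1.residueCard : ℝ) ^ (-x₁)) :=
        Finset.prod_le_prod (fun _ _ => norm_nonneg _) fun v _ => norm_one_sub_residueCard_cpow_neg_le_exp v.1 hw
    _ = Real.exp (∑ v ∈ T, (v.1.residueCard : ℝ) ^ (-x₁)) := by rw [Real.exp_sum]
    _ ≤ Real.exp (∑' v : HeightOneSpectrum (𝓞 K), (v.residueCard : ℝ) ^ (-x₁)) := by
        refine Real.exp_le_exp.2 ?_
        calc ∑ v ∈ T, (v.1.residueCard : ℝ) ^ (-x₁)
            ≤ ∑' v : {v : HeightOneSpectrum (𝓞 K) // v ∉ S}, (v.1.residueCard : ℝ) ^ (-x₁) :=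
              (hsum.subtype _).sum_le_tsum T fun v _ => by positivity
          _ ≤ ∑' v : HeightOneSpectrum (𝓞 K), (v.residueCard : ℝ) ^ (-x₁) :=
              hsum.tsum_subtype_le (fun v : HeightOneSpectrum (𝓞 K) => (v.residueCard : ℝ) ^ (-x₁)) _ fun v => by positivity

/-- **UNIFORM INVERSE PARTIAL ZETA BOUND.**  For `x₁ > 1` there is ONE constant `C > 0` (`C = exp(Σ_v q_v^{−x₁})`) such that for EVERY set `S` of finite places
of `K` (finite or not) and every `w` with `Re w ≥ x₁`:  `‖ζ^S_K(w)⁻¹‖ ≤ C`, `ζ^S_K(w) = partialStandardL S (fun _ => {1}) w = ∏'_{v∉S}(1 − q_v^{−w})⁻¹`.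
Proof: `ζ^S_K(w)⁻¹` is the `HasProd`-value of `v ∉ S ↦ 1 − q_v^{−w}` (★ `hasProd_partialDedekindZeta`, inverted), and every partial product has norm
`≤ exp(Σ_v q_v^{−x₁})` (`norm_prod_one_sub_residueCard_cpow_neg_le`); norms pass to the limit. [cite: NeukirchANT1999, Ch. VII (5.2)] -/
theorem norm_inv_partialZeta_le_uniform {x₁ : ℝ} (hx₁ : 1 < x₁) :
    ∃ C : ℝ, 0 < C ∧ ∀ (S : Set (HeightOneSpectrum (𝓞 K))) (w : ℂ), x₁ ≤ w.re →
      ‖(partialStandardL S (fun _ => ({1} : Multiset ℂ)) w)⁻¹‖ ≤ C := by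
  refine ⟨Real.exp (∑' v : HeightOneSpectrum (𝓞 K), (v.residueCard : ℝ) ^ (-x₁)), Real.exp_pos _, fun S w hw => ?_⟩
  have hw1 : 1 < w.re := lt_of_lt_of_le hx₁ hw
  obtain ⟨hprod, hne⟩ := hasProd_partialDedekindZeta (K := K) (S := S) hw1
  -- invert the Euler product: `∏'_{v∉S} (1 − q_v^{−w}) = ζ^S_K(w)⁻¹`
  have hinv : Tendsto (fun T : Finset {v : HeightOneSpectrum (𝓞 K) // v ∉ S} => ∏ v ∈ T, (1 - (v.1.residueCard : ℂ) ^ (-w))) atTop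
      (𝓝 (partialStandardL S (fun _ => ({1} : Multiset ℂ)) w)⁻¹) := by
    have h : Tendsto (fun T : Finset {v : HeightOneSpectrum (𝓞 K) // v ∉ S} => ∏ v ∈ T, (1 - (v.1.residueCard : ℂ) ^ (-w))⁻¹) atTop
        (𝓝 (partialStandardL S (fun _ => ({1} : Multiset ℂ)) w)) := hprod
    simpa only [Finset.prod_inv_distrib, inv_inv] using h.inv₀ hne
  exact le_of_tendsto' hinv.norm fun T => norm_prod_one_sub_residueCard_cpow_neg_le hx₁ S hw T

/-- **UNIFORM INVERSE PARTIAL ZETA BOUND AT `2z`** (the form W5-FINAL's (hWbd) reads): for `x₀ > ½` there is ONE `C > 0` with `‖ζ^S_K(2z)⁻¹‖ ≤ C` for EVERY set `S`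
of finite places and every `z` with `Re z ≥ x₀` — the `ξ`-dependent finite set `S(η)` of the Whittaker closed form is therefore harmless.
[cite: NeukirchANT1999, Ch. VII (5.2)] [cite: MoeglinWaldspurger1995, I.2.10] -/
theorem norm_inv_partialZeta_two_mul_le_uniform {x₀ : ℝ} (hx₀ : 1 / 2 < x₀) :
    ∃ C : ℝ, 0 < C ∧ ∀ (S : Set (HeightOneSpectrum (𝓞 K))) (z : ℂ), x₀ ≤ z.re →
      ‖(partialStandardL S (fun _ => ({1} : Multiset ℂ)) (2 * z))⁻¹‖ ≤ C := by
  obtain ⟨C, hC, h⟩ := norm_inv_partialZeta_le_uniform (K := K) (x₁ := 2 * x₀) (by linarith)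
  refine ⟨C, hC, fun S z hz => h S (2 * z) ?_⟩
  have h2 : (2 * z).re = 2 * z.re := by simp [Complex.mul_re]
  rw [h2]; linarith

/-! ## §2 Integer arithmetic: `n + 1 ≤ q^n`, `2(n+1) ≤ q^{2n}` (`n ≥ 1`) for `q ≥ 2` -/

/-- `2(n + 1) ≤ 4^n` for `n ≥ 1`. [folklore] -/
theorem two_mul_succ_le_four_pow {n : ℕ} (hn : 1 ≤ n) : 2 * (n + 1) ≤ 4 ^ n := by
  induction n with
  | zero => exact absurd hn (by norm_num)
  | succ k ih =>
    rcases Nat.eq_zero_or_pos k with hk | hk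
    · subst hk; norm_num
    · have h := ih hk
      calc 2 * (k + 1 + 1) = 2 * (k + 1) + 2 := by ring
        _ ≤ 4 ^ k + 2 := by omega
        _ ≤ 4 ^ k * 4 := by have : 1 ≤ 4 ^ k := Nat.one_le_pow _ _ (by norm_num); omega
        _ = 4 ^ (k + 1) := by rw [pow_succ]

/-- `n + 1 ≤ q^n` for a real `q ≥ 2` (`n + 1 ≤ 2^n`). [folklore] -/
theorem succ_le_pow_of_two_le {q : ℝ} (hq : 2 ≤ q) (n : ℕ) : (n : ℝ) + 1 ≤ q ^ n :=
  calc (n : ℝ) + 1 = ((n + 1 : ℕ) : ℝ) := by push_cast; ring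
    _ ≤ ((2 ^ n : ℕ) : ℝ) := by exact_mod_cast Nat.lt_two_pow_self
    _ = (2 : ℝ) ^ n := by push_cast; ring
    _ ≤ q ^ n := pow_le_pow_left₀ (by norm_num) hq n

/-- `2(n + 1) ≤ q^{2n}` for a real `q ≥ 2` and `n ≥ 1` (`2(n+1) ≤ 4^n ≤ (q^2)^n`). [folklore] -/
theorem two_mul_succ_le_pow_two_mul_of_two_le {q : ℝ} (hq : 2 ≤ q) {n : ℕ} (hn : 1 ≤ n) : 2 * ((n : ℝ) + 1) ≤ q ^ (2 * n) :=
  calc 2 * ((n : ℝ) + 1) = ((2 * (n + 1) : ℕ) : ℝ) := by push_cast; ring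
    _ ≤ ((4 ^ n : ℕ) : ℝ) := by exact_mod_cast two_mul_succ_le_four_pow hn
    _ = ((2 : ℝ) ^ 2) ^ n := by push_cast; norm_num
    _ ≤ (q ^ 2) ^ n := pow_le_pow_left₀ (by norm_num) (pow_le_pow_left₀ (by norm_num) hq 2) n
    _ = q ^ (2 * n) := by rw [pow_mul]

/-! ## §3 The product formula in the campaign's currency -/

/-- **The normalised absolute value at a finite place in `exp`-currency**: if `v.valuation K ξ = exp k` then `‖ξ‖_v = adicAbv K v ξ = q_v^k`
(`q_v = v.residueCard = absNorm v`; `k = −ord_v ξ`). [cite: NeukirchANT1999, Ch. III (1.3)] -/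
theorem adicAbv_eq_zpow_of_valuation_eq (v : HeightOneSpectrum (𝓞 K)) {ξ : K} {k : ℤ} (h : v.valuation K ξ = WithZero.exp k) :
    NumberField.HeightOneSpectrum.adicAbv K v ξ = (v.residueCard : ℝ) ^ k := by
  rw [NumberField.HeightOneSpectrum.adicAbv_def, h, WithZero.exp, WithZeroMulInt.toNNReal_neg_apply _ WithZero.coe_ne_zero]
  push_cast
  rw [WithZero.unzero_coe, toAdd_ofAdd]
  rfl

/-- **Monotonicity**: if `v.valuation K ξ ≤ exp k` then `‖ξ‖_v ≤ q_v^k`. [cite: NeukirchANT1999, Ch. III (1.3)] -/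
theorem adicAbv_le_zpow_of_valuation_le (v : HeightOneSpectrum (𝓞 K)) {ξ : K} {k : ℤ} (h : v.valuation K ξ ≤ WithZero.exp k) :
    NumberField.HeightOneSpectrum.adicAbv K v ξ ≤ (v.residueCard : ℝ) ^ k := by
  have hmono := (WithZeroMulInt.toNNReal_strictMono (NumberField.HeightOneSpectrum.one_lt_absNorm_nnreal v)).monotone h
  rw [NumberField.HeightOneSpectrum.adicAbv_def]
  have hk : ((WithZeroMulInt.toNNReal (NumberField.HeightOneSpectrum.absNorm_ne_zero v) (WithZero.exp k) : ℝ≥0) : ℝ) = (v.residueCard : ℝ) ^ k := by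
    rw [WithZero.exp, WithZeroMulInt.toNNReal_neg_apply _ WithZero.coe_ne_zero]
    push_cast
    rw [WithZero.unzero_coe, toAdd_ofAdd]
    rfl
  rw [← hk]
  exact_mod_cast hmono

/-- **Finite part of the product formula, place by place over `HeightOneSpectrum`**: for `ξ ≠ 0`, `v ↦ ‖ξ‖_v` has finite multiplicative support and
`∏ᶠ_v ‖ξ‖_v = |N_{K∕ℚ} ξ|⁻¹` (Mathlib `FinitePlace.prod_eq_inv_abs_norm`, transported along `FinitePlace K ≃ HeightOneSpectrum (𝓞 K)`). [cite: NeukirchANT1999, Ch. III (1.3)] -/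
theorem finprod_adicAbv_eq_inv_abs_norm {ξ : K} (hξ : ξ ≠ 0) :
    (Function.mulSupport fun v : HeightOneSpectrum (𝓞 K) => NumberField.HeightOneSpectrum.adicAbv K v ξ).Finite ∧
      ∏ᶠ v : HeightOneSpectrum (𝓞 K), NumberField.HeightOneSpectrum.adicAbv K v ξ = |(Algebra.norm ℚ ξ : ℝ)|⁻¹ := by
  have hfun : (fun v : HeightOneSpectrum (𝓞 K) => NumberField.HeightOneSpectrum.adicAbv K v ξ) =
      (fun w : FinitePlace K => w ξ) ∘ FinitePlace.equivHeightOneSpectrum.symm := by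
    funext v
    simp only [Function.comp_apply, FinitePlace.equivHeightOneSpectrum_symm_apply, FinitePlace.norm_embedding]
  refine ⟨?_, ?_⟩
  · rw [hfun]
    exact (FinitePlace.hasFiniteMulSupport hξ).comp_of_injective FinitePlace.equivHeightOneSpectrum.symm.injective
  · have hcomp : ∏ᶠ v : HeightOneSpectrum (𝓞 K), (fun w : FinitePlace K => w ξ) (FinitePlace.equivHeightOneSpectrum.symm v) =
        ∏ᶠ w : FinitePlace K, (fun w : FinitePlace K => w ξ) w :=
      finprod_comp_equiv (f := fun w : FinitePlace K => w ξ) FinitePlace.equivHeightOneSpectrum.symm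
    rw [hfun, Function.comp_def, hcomp, FinitePlace.prod_eq_inv_abs_norm hξ]
    push_cast
    rfl

/-- **Infinite part, as an inequality**: `|N_{K∕ℚ} ξ| = ∏_{w∣∞} |ξ|_w^{mult w} ≤ ‖ξ_∞‖^{[K:ℚ]}`, `‖ξ_∞‖` the (sup) norm of `mixedEmbedding K ξ ∈ ℝ^{r₁} × ℂ^{r₂}`
(Mathlib `InfinitePlace.prod_eq_abs_norm`, `normAtPlace_apply`, `norm_eq_sup'_normAtPlace`, `sum_mult_eq`). [cite: NeukirchANT1999, Ch. III (1.3)] -/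
theorem abs_norm_le_norm_mixedEmbedding_pow (ξ : K) :
    |(Algebra.norm ℚ ξ : ℝ)| ≤ ‖mixedEmbedding K ξ‖ ^ finrank ℚ K := by
  have hle : ∀ w : InfinitePlace K, w ξ ≤ ‖mixedEmbedding K ξ‖ := fun w => by
    rw [← mixedEmbedding.normAtPlace_apply w ξ, mixedEmbedding.norm_eq_sup'_normAtPlace]
    exact Finset.le_sup' (fun w => mixedEmbedding.normAtPlace w (mixedEmbedding K ξ)) (Finset.mem_univ w)
  have h := InfinitePlace.prod_eq_abs_norm ξ
  calc |(Algebra.norm ℚ ξ : ℝ)| = ∏ w : InfinitePlace K, w ξ ^ w.mult := by rw [h]; push_cast; rfl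
    _ ≤ ∏ w : InfinitePlace K, ‖mixedEmbedding K ξ‖ ^ w.mult :=
        Finset.prod_le_prod (fun w _ => pow_nonneg (apply_nonneg w ξ) _) fun w _ => pow_le_pow_left₀ (apply_nonneg w ξ) (hle w) _
    _ = ‖mixedEmbedding K ξ‖ ^ finrank ℚ K := by rw [Finset.prod_pow_eq_pow_sum, InfinitePlace.sum_mult_eq]

/-- **`∏_{v∈T} q_v^{n_v} ≤ C_e · |N_{K∕ℚ} ξ|` — the product formula as a divisor bound.**  Let `e : v ↦ e_v ∈ ℤ` vanish off a finite set and put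
`C_e := ∏_{v : e_v ≠ 0} q_v^{−e_v}`.  If `ξ ∈ Kˣ` lies in the box `∏_v 𝔭_v^{e_v}` (`v.valuation K ξ ≤ exp(−e_v)`, i.e. `ord_v ξ ≥ e_v`, at EVERY `v`) and
`v.valuation K ξ = exp(−(e_v + n_v))` (`ord_v ξ = e_v + n_v`) on a finite set `T`, then `∏_{v∈T} q_v^{n_v} ≤ C_e · |N_{K∕ℚ} ξ|`: indeed `q_v^{n_v} = q_v^{−e_v}∕‖ξ‖_v`
on `T`, every factor `q_v^{−e_v}∕‖ξ‖_v` is `≥ 1`, and their full (finite) product is `C_e · (∏ᶠ_v ‖ξ‖_v)⁻¹ = C_e·|N ξ|`. [cite: NeukirchANT1999, Ch. III (1.3)] -/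
theorem prod_residueCard_pow_le_mul_abs_norm {e : HeightOneSpectrum (𝓞 K) → ℤ} (he : ∀ᶠ v in cofinite, e v = 0)
    {ξ : K} (hξ : ξ ≠ 0) (hbox : ∀ v : HeightOneSpectrum (𝓞 K), v.valuation K ξ ≤ WithZero.exp (-e v))
    (T : Finset (HeightOneSpectrum (𝓞 K))) (n : HeightOneSpectrum (𝓞 K) → ℕ)
    (hT : ∀ v ∈ T, v.valuation K ξ = WithZero.exp (-(e v + n v))) :
    ∏ v ∈ T, (v.residueCard : ℝ) ^ (n v) ≤ (∏ v ∈ he.toFinset, (v.residueCard : ℝ) ^ (-e v)) * |(Algebra.norm ℚ ξ : ℝ)| := by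
  classical
  -- notation: `f v = ‖ξ‖_v`, `g v = q_v^{−e_v} / f v`
  set f : HeightOneSpectrum (𝓞 K) → ℝ := fun v => NumberField.HeightOneSpectrum.adicAbv K v ξ with hf
  set g : HeightOneSpectrum (𝓞 K) → ℝ := fun v => (v.residueCard : ℝ) ^ (-e v) / f v with hg
  have hq : ∀ v : HeightOneSpectrum (𝓞 K), (1 : ℝ) < v.residueCard := fun v => by exact_mod_cast v.one_lt_residueCard
  have hfpos : ∀ v, 0 < f v := fun v => (NumberField.HeightOneSpectrum.adicAbv K v).pos hξ
  have hg1 : ∀ v, 1 ≤ g v := fun v => by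
    rw [hg]
    exact (one_le_div (hfpos v)).2 (adicAbv_le_zpow_of_valuation_le v (hbox v))
  have hgT : ∀ v ∈ T, g v = (v.residueCard : ℝ) ^ (n v) := fun v hv => by
    have hfv : f v = (v.residueCard : ℝ) ^ (-(e v + (n v : ℤ))) := adicAbv_eq_zpow_of_valuation_eq v (hT v hv)
    rw [hg]
    simp only
    rw [hfv, div_eq_iff (zpow_pos (zero_lt_one.trans (hq v)) _).ne', ← zpow_natCast, ← zpow_add₀ (zero_lt_one.trans (hq v)).ne']
    congr 1
    ring
  -- the finite set carrying everything
  obtain ⟨hfin, hprod⟩ := finprod_adicAbv_eq_inv_abs_norm (K := K) hξ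
  set U : Finset (HeightOneSpectrum (𝓞 K)) := T ∪ he.toFinset ∪ hfin.toFinset with hU
  have hTU : T ⊆ U := Finset.subset_union_left.trans Finset.subset_union_left
  -- `∏_{v∈T} q^{n_v} = ∏_{v∈T} g ≤ ∏_{v∈U} g`
  have h1 : ∏ v ∈ T, (v.residueCard : ℝ) ^ (n v) = ∏ v ∈ T, g v := Finset.prod_congr rfl fun v hv => (hgT v hv).symm
  have h2 : ∏ v ∈ T, g v ≤ ∏ v ∈ U, g v :=
    Finset.prod_le_prod_of_subset_of_one_le hTU (fun v _ => zero_le_one.trans (hg1 v)) fun v _ _ => hg1 v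
  -- `∏_{v∈U} g = (∏_{v∈U} q^{−e}) / (∏_{v∈U} f)`, and the two products are `C_e` and `|N ξ|⁻¹`
  have h3 : ∏ v ∈ U, g v = (∏ v ∈ U, (v.residueCard : ℝ) ^ (-e v)) / ∏ v ∈ U, f v := by
    rw [hg, Finset.prod_div_distrib]
  have h4 : ∏ v ∈ U, (v.residueCard : ℝ) ^ (-e v) = ∏ v ∈ he.toFinset, (v.residueCard : ℝ) ^ (-e v) := by
    symm
    refine Finset.prod_subset (Finset.subset_union_right.trans Finset.subset_union_left) fun v _ hv => ?_
    have hv0 : e v = 0 := by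
      by_contra h
      exact hv (he.mem_toFinset.2 h)
    rw [hv0, neg_zero, zpow_zero]
  have h5 : ∏ v ∈ U, f v = |(Algebra.norm ℚ ξ : ℝ)|⁻¹ := by
    rw [← hprod]
    symm
    exact finprod_eq_prod_of_mulSupport_subset f fun v hv => Finset.subset_union_right (hfin.mem_toFinset.2 hv)
  rw [h1]
  refine h2.trans (le_of_eq ?_)
  rw [h3, h4, h5, div_inv_eq_mul]

/-! ## §4 HEAD: the «product-formula bound» of the W5-FINAL wiring table -/

/-- **PRODUCT-FORMULA BOUND (W5-FINAL (hWbd), divisor step).**  Let `K` be a number field, `e : v ↦ e_v ∈ ℤ` finitely supported (the box exponents: conductor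
exponents `m_v`, the `δ`-breakpoints `−k⁰_v`, the valuations of the line idele `α_F`), and `S₀` a finite set of places (where a factor with `n_v = 0` may occur).
There is ONE constant `C > 0` such that for every `ξ ∈ Kˣ` in the box (`v.valuation K ξ ≤ exp(−e_v)` for all `v`), every finite set `T` of places and every
`n : v ↦ n_v ∈ ℕ` with `v.valuation K ξ = exp(−(e_v + n_v))` and (`v ∈ S₀` or `n_v ≥ 1`) for `v ∈ T`:
  `∏_{v ∈ T} 2·(n_v + 1) ≤ C · (1 + ‖ξ_∞‖)^{2[K:ℚ]}`,   `‖ξ_∞‖ = ‖mixedEmbedding K ξ‖`.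
(`2(n+1) ≤ 2·q_v^{2n}` always and `≤ q_v^{2n}` if `n ≥ 1`, so the left side is `≤ 2^{#S₀}·(∏_{v∈T} q_v^{n_v})² ≤ 2^{#S₀}·C_e²·|N ξ|² ≤ 2^{#S₀} C_e² (1 + ‖ξ_∞‖)^{2[K:ℚ]}`
by §3.)  This is the bound `∏_{v ∈ S(η)} ‖W_v(z, η_v)‖ ≤ ∏ 2(n_v(η) + 1) ≪ (1 + ‖ξ_∞‖)^a` of the finite Whittaker factors (★ p858310 `norm_closedForm_le`), uniform in the
`ξ`-dependent set `S(η)`, with `a = 2[K:ℚ]`. [cite: Garrett2018, §2.8] [cite: NeukirchANT1999, Ch. III (1.3)] -/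
theorem exists_prod_two_mul_succ_le {e : HeightOneSpectrum (𝓞 K) → ℤ} (he : ∀ᶠ v in cofinite, e v = 0) (S₀ : Finset (HeightOneSpectrum (𝓞 K))) :
    ∃ C : ℝ, 0 < C ∧ ∀ ξ : K, ξ ≠ 0 → (∀ v : HeightOneSpectrum (𝓞 K), v.valuation K ξ ≤ WithZero.exp (-e v)) →
      ∀ (T : Finset (HeightOneSpectrum (𝓞 K))) (n : HeightOneSpectrum (𝓞 K) → ℕ),
        (∀ v ∈ T, v.valuation K ξ = WithZero.exp (-(e v + n v)) ∧ (v ∈ S₀ ∨ 1 ≤ n v)) →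
        ∏ v ∈ T, 2 * ((n v : ℝ) + 1) ≤ C * (1 + ‖mixedEmbedding K ξ‖) ^ (2 * finrank ℚ K) := by
  classical
  set Ce : ℝ := ∏ v ∈ he.toFinset, (v.residueCard : ℝ) ^ (-e v) with hCe
  have hq : ∀ v : HeightOneSpectrum (𝓞 K), (2 : ℝ) ≤ v.residueCard := fun v => by exact_mod_cast v.one_lt_residueCard
  have hCe0 : 0 < Ce := Finset.prod_pos fun v _ => zpow_pos (by linarith [hq v]) _
  refine ⟨2 ^ S₀.card * Ce ^ 2, by positivity, fun ξ hξ hbox T n hT => ?_⟩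
  have hmain := prod_residueCard_pow_le_mul_abs_norm he hξ hbox T n fun v hv => (hT v hv).1
  have hN := abs_norm_le_norm_mixedEmbedding_pow ξ
  set P : ℝ := ∏ v ∈ T, (v.residueCard : ℝ) ^ (n v) with hP
  have hP0 : 0 ≤ P := Finset.prod_nonneg fun v _ => pow_nonneg (by linarith [hq v]) _
  set x : ℝ := ‖mixedEmbedding K ξ‖ with hx
  have hx0 : 0 ≤ x := norm_nonneg _
  -- (1) termwise: `2(n_v+1) ≤ (2 if v ∈ S₀ else 1) · q_v^{2 n_v}`
  have hterm : ∀ v ∈ T, 2 * ((n v : ℝ) + 1) ≤ (if v ∈ S₀ then (2 : ℝ) else 1) * ((v.residueCard : ℝ) ^ (n v)) ^ 2 := fun v hv => by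
    rw [← pow_mul, mul_comm (n v) 2]
    split_ifs with hv0
    · have h := succ_le_pow_of_two_le (hq v) (n v)
      have h' : (v.residueCard : ℝ) ^ (n v) ≤ (v.residueCard : ℝ) ^ (2 * n v) :=
        pow_le_pow_right₀ (by linarith [hq v]) (by omega)
      linarith
    · rcases (hT v hv).2 with h0 | h1
      · exact absurd h0 hv0
      · rw [one_mul]; exact two_mul_succ_le_pow_two_mul_of_two_le (hq v) h1
  -- (2) multiply up: `∏_T 2(n_v+1) ≤ 2^{#(T ∩ S₀)} · P² ≤ 2^{#S₀} · P²`
  have hstep : ∏ v ∈ T, 2 * ((n v : ℝ) + 1) ≤ 2 ^ S₀.card * P ^ 2 := by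
    calc ∏ v ∈ T, 2 * ((n v : ℝ) + 1) ≤ ∏ v ∈ T, ((if v ∈ S₀ then (2 : ℝ) else 1) * ((v.residueCard : ℝ) ^ (n v)) ^ 2) :=
          Finset.prod_le_prod (fun v _ => by positivity) hterm
      _ = (∏ v ∈ T, (if v ∈ S₀ then (2 : ℝ) else 1)) * P ^ 2 := by rw [Finset.prod_mul_distrib, Finset.prod_pow]
      _ ≤ 2 ^ S₀.card * P ^ 2 := by
          refine mul_le_mul_of_nonneg_right ?_ (by positivity)
          rw [Finset.prod_ite, Finset.prod_const_one, mul_one, Finset.prod_const]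
          exact pow_le_pow_right₀ (by norm_num) (Finset.card_le_card fun v hv => (Finset.mem_filter.1 hv).2)
  -- (3) `P ≤ Ce·|N ξ| ≤ Ce·(1+x)^d`
  have hPle : P ≤ Ce * (1 + x) ^ finrank ℚ K := by
    calc P ≤ Ce * |(Algebra.norm ℚ ξ : ℝ)| := hmain
      _ ≤ Ce * x ^ finrank ℚ K := mul_le_mul_of_nonneg_left hN hCe0.le
      _ ≤ Ce * (1 + x) ^ finrank ℚ K := mul_le_mul_of_nonneg_left (pow_le_pow_left₀ hx0 (by linarith) _) hCe0.le
  calc ∏ v ∈ T, 2 * ((n v : ℝ) + 1) ≤ 2 ^ S₀.card * P ^ 2 := hstep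
    _ ≤ 2 ^ S₀.card * (Ce * (1 + x) ^ finrank ℚ K) ^ 2 := by gcongr
    _ = 2 ^ S₀.card * Ce ^ 2 * (1 + x) ^ (2 * finrank ℚ K) := by ring

/-- **THE SAME BOUND IN W4's LETTERS.**  W4 (★ `K2E1WhittakerSeriesConvergenceU2`) measures `ξ` by `‖ξ_∞‖ = ‖ringEquiv_mixedSpace K (algebraMap K 𝔸_K ξ).1‖`; this
IS `‖mixedEmbedding K ξ‖` (Mathlib `InfiniteAdeleRing.mixedEmbedding_eq_algebraMap_comp`), so §4 reads verbatim in that currency. [cite: Garrett2018, §2.8] -/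
theorem exists_prod_two_mul_succ_le_infiniteAdele {e : HeightOneSpectrum (𝓞 K) → ℤ} (he : ∀ᶠ v in cofinite, e v = 0)
    (S₀ : Finset (HeightOneSpectrum (𝓞 K))) :
    ∃ C : ℝ, 0 < C ∧ ∀ ξ : K, ξ ≠ 0 → (∀ v : HeightOneSpectrum (𝓞 K), v.valuation K ξ ≤ WithZero.exp (-e v)) →
      ∀ (T : Finset (HeightOneSpectrum (𝓞 K))) (n : HeightOneSpectrum (𝓞 K) → ℕ),
        (∀ v ∈ T, v.valuation K ξ = WithZero.exp (-(e v + n v)) ∧ (v ∈ S₀ ∨ 1 ≤ n v)) →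
        ∏ v ∈ T, 2 * ((n v : ℝ) + 1) ≤
          C * (1 + ‖InfiniteAdeleRing.ringEquiv_mixedSpace K (algebraMap K (AdeleRing (𝓞 K) K) ξ).1‖) ^ (2 * finrank ℚ K) := by
  obtain ⟨C, hC, h⟩ := exists_prod_two_mul_succ_le he S₀
  refine ⟨C, hC, fun ξ hξ hbox T n hT => ?_⟩
  have hx : InfiniteAdeleRing.ringEquiv_mixedSpace K (algebraMap K (AdeleRing (𝓞 K) K) ξ).1 = mixedEmbedding K ξ := by
    rw [InfiniteAdeleRing.mixedEmbedding_eq_algebraMap_comp]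
    rfl
  rw [hx]
  exact h ξ hξ hbox T n hT

/-! ## §5 Dictionary for the consumer: local balls at a `K`-point ↔ the global valuation -/

/-- **`(ξ : K_v) ∈ 𝔭_v^m ⟺ v.valuation K ξ ≤ exp(−m)`** (★ `mem_primePowBall_adicCompletion_iff` with Mathlib `valuedAdicCompletion_eq_valuation'`): the binders
`hn : η_v ∈ 𝔭^{m+n}`, `hn' : η_v ∉ 𝔭^{m+n+1}` of ★ `K2E1FiniteWhittakerPolynomial` at a `K`-point become `v.valuation K ξ = exp(−(m+n))` (`valuation_eq_exp_of_mem_of_not_mem`).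
[cite: NeukirchANT1999, Ch. II §3] -/
theorem coe_mem_primePowBall_iff_valuation_le (v : HeightOneSpectrum (𝓞 K)) (ξ : K) (m : ℤ) :
    (ξ : v.adicCompletion K) ∈ primePowBall (v.adicCompletion K) m ↔ v.valuation K ξ ≤ WithZero.exp (-m) := by
  rw [mem_primePowBall_adicCompletion_iff, HeightOneSpectrum.valuedAdicCompletion_eq_valuation']

/-- **Shell membership pins the valuation**: `(ξ : K_v) ∈ 𝔭_v^k ∖ 𝔭_v^{k+1}` iff `v.valuation K ξ = exp(−k)` (the valuation is `exp` of an integer or `0`).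
[cite: NeukirchANT1999, Ch. II §3] -/
theorem valuation_eq_exp_of_mem_of_not_mem (v : HeightOneSpectrum (𝓞 K)) {ξ : K} {k : ℤ}
    (hk : (ξ : v.adicCompletion K) ∈ primePowBall (v.adicCompletion K) k) (hk' : (ξ : v.adicCompletion K) ∉ primePowBall (v.adicCompletion K) (k + 1)) :
    v.valuation K ξ = WithZero.exp (-k) := by
  rw [coe_mem_primePowBall_iff_valuation_le] at hk hk'
  have hne : v.valuation K ξ ≠ 0 := by
    intro h0
    exact hk' (by rw [h0]; exact zero_le)
  rw [← WithZero.exp_log hne] at hk hk' ⊢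
  rw [WithZero.exp_le_exp] at hk
  rw [WithZero.exp_le_exp, not_le] at hk'
  rw [WithZero.exp_inj]
  omega

/-- **§4 IN THE LOCAL-BALL CURRENCY OF ★ `K2E1FiniteWhittakerPolynomial`** (the case `η_v = ξ`, e.g. `g ∈ K_U`): with the box stated as `(ξ : K_v) ∈ 𝔭_v^{e_v}` for
all `v` and the `T`-condition as the shell `(ξ : K_v) ∈ 𝔭_v^{e_v + n_v} ∖ 𝔭_v^{e_v + n_v + 1}` (★ p858310's binders `hn`, `hn'` with `m = e_v`), the same ONE constant
gives `∏_{v∈T} 2(n_v + 1) ≤ C·(1 + ‖ξ_∞‖)^{2[K:ℚ]}`. [cite: Garrett2018, §2.8] [cite: NeukirchANT1999, Ch. III (1.3)] -/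
theorem exists_prod_two_mul_succ_le_of_mem_primePowBall {e : HeightOneSpectrum (𝓞 K) → ℤ} (he : ∀ᶠ v in cofinite, e v = 0)
    (S₀ : Finset (HeightOneSpectrum (𝓞 K))) :
    ∃ C : ℝ, 0 < C ∧ ∀ ξ : K, ξ ≠ 0 → (∀ v : HeightOneSpectrum (𝓞 K), (ξ : v.adicCompletion K) ∈ primePowBall (v.adicCompletion K) (e v)) →
      ∀ (T : Finset (HeightOneSpectrum (𝓞 K))) (n : HeightOneSpectrum (𝓞 K) → ℕ),
        (∀ v ∈ T, (ξ : v.adicCompletion K) ∈ primePowBall (v.adicCompletion K) (e v + n v) ∧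
          (ξ : v.adicCompletion K) ∉ primePowBall (v.adicCompletion K) (e v + n v + 1) ∧ (v ∈ S₀ ∨ 1 ≤ n v)) →
        ∏ v ∈ T, 2 * ((n v : ℝ) + 1) ≤ C * (1 + ‖mixedEmbedding K ξ‖) ^ (2 * finrank ℚ K) := by
  obtain ⟨C, hC, h⟩ := exists_prod_two_mul_succ_le he S₀
  refine ⟨C, hC, fun ξ hξ hbox T n hT =>
    h ξ hξ (fun v => (coe_mem_primePowBall_iff_valuation_le v ξ (e v)).1 (hbox v)) T n fun v hv => ?_⟩
  obtain ⟨h1, h2, h3⟩ := hT v hv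
  exact ⟨valuation_eq_exp_of_mem_of_not_mem v h1 h2, h3⟩

end Summit.HodgeConjecture.HodgeConjecture.Cruxes.H413.K2E1WhittakerBoundsUniformU2

end
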